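import Literature.NumberTheory.Sieve.CFSemigroupLipOperator
import HarnessLib

/-!
# Holomorphy of `s ↦ L_s` on the Lipschitz space

Support file (all results proved) for the named fact
`Literature.NumberTheory.Sieve.MageeOhWinter2019_uniformCounting` (`CFSemigroupCounting.lean`).
The renewal/Laplace-transform analysis of [MageeOhWinter2019, §3.4] ("the correspondence
`s ↦ n_q(s, x, φ)` gives a holomorphic family of `C¹` functions … this is essential for the contour
shifting argument") and the perturbation theory of the leading eigenvalue both rest on the fact
that the transfer operators `L_s`, as bounded operators on the Banach space of regular functions on
`[0,1]`, depend holomorphically on `s`. We prove this for the operators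
`cfLOp A hA s : CfLip →L[ℂ] CfLip` of `CFSemigroupLipOperator.lean`:

* `cfWOp`: generic weighted composition operators `F ↦ Σ_a ω_a(x) F(1/(x+a))` on `CfLip` with the
  norm bound `Σ_a (2 sup|ω_a| + Lip(ω_a))` (`norm_cfWOp_le`);
* `cfLOpD A hA s`: the derivative operator, weights `-2 log(x+a) · (x+a)^{-2s}`;
* `norm_cfLOp_taylor_le`: the second-order Taylor estimate
  `‖L_{s+k} - L_s - k L'_s‖ ≤ C(s) ‖k‖²` for `‖k‖ ≤ 1/4` (explicit `C(s) = cfTaylorConst A s`);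
* `hasDerivAt_cfLOp`, `differentiable_cfLOp`, `analyticAt_cfLOp`: `s ↦ L_s` is an entire
  operator-valued function. [cite: MageeOhWinter2019, §3.4]

## References

* M. Magee, H. Oh, D. Winter, J. reine angew. Math. 753 (2019) 89–135, §3.4.
  [MageeOhWinter2019]
-/

noncomputable section

open Set Filter Asymptotics
open scoped Topology

namespace Literature.NumberTheory.Sieve

variable {A : Finset ℕ}

/-! ### Elementary bounds for the branches and the single-letter weights -/

/-- The branches are `1`-Lipschitz on `[0,1]`: `|1/(x+a) - 1/(y+a)| ≤ |x - y|` (`a ≥ 1`).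
[folklore] -/
theorem abs_one_div_add_sub_le {a : ℕ} (ha : 1 ≤ a) {x y : ℝ} (hx : x ∈ Icc (0 : ℝ) 1)
    (hy : y ∈ Icc (0 : ℝ) 1) : |1 / (x + a) - 1 / (y + a)| ≤ |x - y| := by
  have ha1 : (1 : ℝ) ≤ a := by exact_mod_cast ha
  have hxa : 1 ≤ x + a := by linarith [hx.1]
  have hya : 1 ≤ y + a := by linarith [hy.1]
  have e : 1 / (x + a) - 1 / (y + a) = (y - x) / ((x + a) * (y + a)) := by
    field_simp
    ring
  rw [e, abs_div, abs_of_pos (by positivity : 0 < (x + a) * (y + a)), abs_sub_comm]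
  exact div_le_self (abs_nonneg _) (by nlinarith)

/-- The per-letter bound `Z_a(σ) = (a²)^{-σ} + ((a+1)²)^{-σ}`. [folklore] -/
def cfZa (a : ℕ) (σ : ℝ) : ℝ := ((a : ℝ) ^ 2) ^ (-σ) + (((a : ℝ) + 1) ^ 2) ^ (-σ)

/-- `Z_a ≥ 0`. [folklore] -/
theorem cfZa_nonneg (a : ℕ) (σ : ℝ) : 0 ≤ cfZa a σ :=
  add_nonneg (Real.rpow_nonneg (sq_nonneg _) _) (Real.rpow_nonneg (sq_nonneg _) _)

/-- The real weight is bounded by `Z_a`: `((x+a)²)^{-σ} ≤ Z_a(σ)` on `[0,1]` (`a ≥ 1`). [folklore] -/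
theorem rpow_add_le_cfZa {a : ℕ} (ha : 1 ≤ a) (σ : ℝ) {x : ℝ} (hx : x ∈ Icc (0 : ℝ) 1) :
    ((x + a) ^ 2) ^ (-σ) ≤ cfZa a σ := by
  have ha1 : (1 : ℝ) ≤ a := by exact_mod_cast ha
  have hlo : (a : ℝ) ^ 2 ≤ (x + a) ^ 2 := by nlinarith [hx.1]
  have hhi : (x + a) ^ 2 ≤ ((a : ℝ) + 1) ^ 2 := by nlinarith [hx.1, hx.2]
  have hpos : (0 : ℝ) < (a : ℝ) ^ 2 := by positivity
  have hn1 : 0 ≤ (((a : ℝ) + 1) ^ 2) ^ (-σ) := Real.rpow_nonneg (sq_nonneg _) _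
  have hn2 : 0 ≤ ((a : ℝ) ^ 2) ^ (-σ) := Real.rpow_nonneg (sq_nonneg _) _
  unfold cfZa
  rcases le_or_gt 0 σ with hσ | hσ
  · have h1 : ((x + a) ^ 2) ^ (-σ) ≤ ((a : ℝ) ^ 2) ^ (-σ) :=
      Real.rpow_le_rpow_of_nonpos hpos hlo (by linarith)
    linarith
  · have h1 : ((x + a) ^ 2) ^ (-σ) ≤ (((a : ℝ) + 1) ^ 2) ^ (-σ) :=
      Real.rpow_le_rpow (sq_nonneg _) hhi (by linarith)
    linarith

/-- **Sup bound for the single-letter weight:** `‖(x+a)^{-2s}‖ ≤ Z_a(Re s)`. [folklore] -/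
theorem norm_cfWt_cfGen_le {a : ℕ} (ha : 1 ≤ a) (s : ℂ) {x : ℝ} (hx : x ∈ Icc (0 : ℝ) 1) :
    ‖cfWt s (cfGen a) x‖ ≤ cfZa a s.re := by
  have hd : 0 < cfDenom (cfGen a) x := by
    rw [cfDenom_cfGen]
    have : (1 : ℝ) ≤ a := by exact_mod_cast ha
    linarith [hx.1]
  rw [norm_cfWt s _ hd, cfDenom_cfGen]
  exact rpow_add_le_cfZa ha s.re hx

/-- **Lipschitz bound for the single-letter weight:**
`‖(x+a)^{-2s} - (y+a)^{-2s}‖ ≤ Z_a(Re s) · 2‖s‖ e^{2‖s‖} |x - y|`. [folklore] -/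
theorem norm_cfWt_cfGen_sub_le {a : ℕ} (ha : 1 ≤ a) (s : ℂ) {x y : ℝ} (hx : x ∈ Icc (0 : ℝ) 1)
    (hy : y ∈ Icc (0 : ℝ) 1) :
    ‖cfWt s (cfGen a) x - cfWt s (cfGen a) y‖ ≤
      cfZa a s.re * (2 * ‖s‖ * Real.exp (2 * ‖s‖)) * |x - y| := by
  have hmat : cfMat (fun _ : Fin 1 => a) = cfGen a := cfMat_fin_one _
  have h := norm_cfWt_sub_cfWt_le (w := fun _ : Fin 1 => a) (fun _ => ha) s hx hy
  rw [hmat] at h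
  refine h.trans ?_
  have hd1 : |x - y| ≤ 1 := by rw [abs_le]; constructor <;> linarith [hx.1, hx.2, hy.1, hy.2]
  have hexp : Real.exp (2 * ‖s‖ * |x - y|) ≤ Real.exp (2 * ‖s‖) :=
    Real.exp_le_exp.2 (by nlinarith [norm_nonneg s, abs_nonneg (x - y)])
  have hw : ((cfDenom (cfGen a) y) ^ 2) ^ (-s.re) ≤ cfZa a s.re := by
    rw [cfDenom_cfGen]; exact rpow_add_le_cfZa ha s.re hy
  have hZ := cfZa_nonneg a s.re
  calc ((cfDenom (cfGen a) y) ^ 2) ^ (-s.re) * (2 * ‖s‖ * Real.exp (2 * ‖s‖ * |x - y|) * |x - y|)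
      ≤ cfZa a s.re * (2 * ‖s‖ * Real.exp (2 * ‖s‖) * |x - y|) := by
        refine mul_le_mul hw ?_ (by positivity) hZ
        exact mul_le_mul_of_nonneg_right (mul_le_mul_of_nonneg_left hexp (by positivity)) (abs_nonneg _)
    _ = _ := by ring

/-- The logarithm `log(x+a)` on `[0,1]`: `0 ≤ log(x+a) ≤ log(a+1)`. [folklore] -/
theorem log_add_mem {a : ℕ} (ha : 1 ≤ a) {x : ℝ} (hx : x ∈ Icc (0 : ℝ) 1) :
    0 ≤ Real.log (x + a) ∧ Real.log (x + a) ≤ Real.log ((a : ℝ) + 1) := by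
  have ha1 : (1 : ℝ) ≤ a := by exact_mod_cast ha
  exact ⟨Real.log_nonneg (by linarith [hx.1]),
    Real.log_le_log (by linarith [hx.1]) (by linarith [hx.2])⟩

/-- The logarithm is `1`-Lipschitz on `[0,1] + a`: `|log(x+a) - log(y+a)| ≤ |x - y|`. [folklore] -/
theorem abs_log_add_sub_le {a : ℕ} (ha : 1 ≤ a) {x y : ℝ} (hx : x ∈ Icc (0 : ℝ) 1)
    (hy : y ∈ Icc (0 : ℝ) 1) : |Real.log (x + a) - Real.log (y + a)| ≤ |x - y| := by
  have ha1 : (1 : ℝ) ≤ a := by exact_mod_cast ha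
  have key : ∀ {u v : ℝ}, 1 ≤ v → 0 < u → Real.log u - Real.log v ≤ |u - v| := by
    intro u v hv hu
    have hv0 : 0 < v := by linarith
    have h1 : Real.log (u / v) ≤ u / v - 1 := Real.log_le_sub_one_of_pos (div_pos hu hv0)
    rw [Real.log_div hu.ne' hv0.ne'] at h1
    have h2 : u / v - 1 = (u - v) / v := by field_simp
    rw [h2] at h1
    calc Real.log u - Real.log v ≤ (u - v) / v := h1
      _ ≤ |u - v| / v := div_le_div_of_nonneg_right (le_abs_self _) hv0.le
      _ ≤ |u - v| := div_le_self (abs_nonneg _) hv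
  have hxa : 0 < x + a := by linarith [hx.1]
  have hya : 0 < y + a := by linarith [hy.1]
  have h1 := key (by linarith [hy.1] : 1 ≤ y + a) hxa
  have h2 := key (by linarith [hx.1] : 1 ≤ x + a) hya
  have e1 : |x + a - (y + a)| = |x - y| := by congr 1; ring
  have e2 : |y + a - (x + a)| = |x - y| := by
    rw [show y + a - (x + a) = -(x - y) by ring, abs_neg]
  rw [e1] at h1
  rw [e2] at h2
  rw [abs_le]
  constructor <;> linarith

/-! ### Generic weighted composition operators on `CfLip` -/

section Generic

variable (A)

/-- The functions `x ↦ Σ_a ω_a(x) F(1/(x+a))`. [folklore] -/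
def cfWFun (ω : ℕ → ℝ → ℂ) (F : CfLip) (x : Icc (0 : ℝ) 1) : ℂ :=
  ∑ a ∈ A, ω a x * F.extend (1 / (x + a))

/-- Pointwise formula. [folklore] -/
@[simp] theorem cfWFun_apply (ω : ℕ → ℝ → ℂ) (F : CfLip) (x : Icc (0 : ℝ) 1) :
    cfWFun A ω F x = ∑ a ∈ A, ω a x * F.extend (1 / (x + a)) := rfl

/-- **Sup bound** for the weighted operator. [folklore] -/
theorem norm_cfWFun_le {ω : ℕ → ℝ → ℂ} {M : ℕ → ℝ}
    (hM : ∀ a ∈ A, ∀ x ∈ Icc (0 : ℝ) 1, ‖ω a x‖ ≤ M a) (F : CfLip) (x : Icc (0 : ℝ) 1) :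
    ‖cfWFun A ω F x‖ ≤ (∑ a ∈ A, M a) * ‖F‖ := by
  rw [cfWFun_apply, Finset.sum_mul]
  refine (norm_sum_le _ _).trans (Finset.sum_le_sum fun a ha => ?_)
  rw [norm_mul]
  exact mul_le_mul (hM a ha x x.2) (F.norm_extend_le _) (norm_nonneg _)
    ((norm_nonneg _).trans (hM a ha x x.2))

variable (hA : ∀ a ∈ A, 1 ≤ a)
include hA

/-- **Lipschitz bound** for the weighted operator. [folklore] -/
theorem norm_cfWFun_sub_le {ω : ℕ → ℝ → ℂ} {M L : ℕ → ℝ}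
    (hM : ∀ a ∈ A, ∀ x ∈ Icc (0 : ℝ) 1, ‖ω a x‖ ≤ M a)
    (hL : ∀ a ∈ A, ∀ x ∈ Icc (0 : ℝ) 1, ∀ y ∈ Icc (0 : ℝ) 1, ‖ω a x - ω a y‖ ≤ L a * |x - y|)
    (F : CfLip) (x y : Icc (0 : ℝ) 1) :
    ‖cfWFun A ω F x - cfWFun A ω F y‖ ≤ (∑ a ∈ A, (L a + M a)) * ‖F‖ * |(x : ℝ) - y| := by
  rw [cfWFun_apply, cfWFun_apply, ← Finset.sum_sub_distrib, Finset.sum_mul, Finset.sum_mul]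
  refine (norm_sum_le _ _).trans (Finset.sum_le_sum fun a ha => ?_)
  have ha1 := hA a ha
  have hux := one_div_add_mem_Icc ha1 x.2
  have huy := one_div_add_mem_Icc ha1 y.2
  have hM0 : 0 ≤ M a := (norm_nonneg _).trans (hM a ha x x.2)
  have e : ω a x * F.extend (1 / (x + a)) - ω a y * F.extend (1 / (y + a)) =
      (ω a x - ω a y) * F.extend (1 / (x + a)) + ω a y * (F.extend (1 / (x + a)) - F.extend (1 / (y + a))) := by
    ring
  rw [e]
  have h1 : ‖(ω a x - ω a y) * F.extend (1 / (x + a))‖ ≤ L a * |(x : ℝ) - y| * ‖F‖ := by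
    rw [norm_mul]
    exact mul_le_mul (hL a ha x x.2 y y.2) (F.norm_extend_le _) (norm_nonneg _)
      ((norm_nonneg _).trans (hL a ha x x.2 y y.2))
  have h2 : ‖ω a y * (F.extend (1 / (x + a)) - F.extend (1 / (y + a)))‖ ≤ M a * (‖F‖ * |(x : ℝ) - y|) := by
    rw [norm_mul]
    refine mul_le_mul (hM a ha y y.2) ?_ (norm_nonneg _) hM0
    exact (F.norm_extend_sub_le hux huy).trans
      (mul_le_mul_of_nonneg_left (abs_one_div_add_sub_le ha1 x.2 y.2) (norm_nonneg _))
  calc ‖(ω a x - ω a y) * F.extend (1 / (x + a)) + ω a y * (F.extend (1 / (x + a)) - F.extend (1 / (y + a)))‖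
      ≤ L a * |(x : ℝ) - y| * ‖F‖ + M a * (‖F‖ * |(x : ℝ) - y|) := (norm_add_le _ _).trans (add_le_add h1 h2)
    _ = (L a + M a) * ‖F‖ * |(x : ℝ) - y| := by ring

/-- **The weighted composition operator** `F ↦ Σ_a ω_a(x) F(1/(x+a))` on `CfLip`, for weights
with sup bounds `M_a ≥ 0` and Lipschitz bounds `L_a ≥ 0`. [folklore] -/
def cfWOp (ω : ℕ → ℝ → ℂ) (M L : ℕ → ℝ) (hM : ∀ a ∈ A, ∀ x ∈ Icc (0 : ℝ) 1, ‖ω a x‖ ≤ M a)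
    (hL : ∀ a ∈ A, ∀ x ∈ Icc (0 : ℝ) 1, ∀ y ∈ Icc (0 : ℝ) 1, ‖ω a x - ω a y‖ ≤ L a * |x - y|)
    (hL0 : ∀ a ∈ A, 0 ≤ L a) : CfLip →L[ℂ] CfLip :=
  LinearMap.mkContinuous
    { toFun := fun F => CfLip.mk' (cfWFun A ω F) ((∑ a ∈ A, (L a + M a)) * ‖F‖)
        (norm_cfWFun_sub_le A hA hM hL F)
      map_add' := fun F G => by
        ext x
        simp only [CfLip.mk'_apply, cfWFun_apply, CfLip.add_apply, ← Finset.sum_add_distrib]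
        exact Finset.sum_congr rfl fun a _ => by rw [CfLip.extend_add]; ring
      map_smul' := fun c F => by
        ext x
        simp only [CfLip.mk'_apply, cfWFun_apply, CfLip.smul_apply, RingHom.id_apply, Finset.mul_sum]
        exact Finset.sum_congr rfl fun a _ => by rw [CfLip.extend_smul]; ring }
    (∑ a ∈ A, (2 * M a + L a)) fun F => by
      have hM0 : ∀ a ∈ A, 0 ≤ M a := fun a ha => (norm_nonneg _).trans (hM a ha _ ⟨le_rfl, zero_le_one⟩)
      have hC : 0 ≤ (∑ a ∈ A, (L a + M a)) * ‖F‖ :=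
        mul_nonneg (Finset.sum_nonneg fun a ha => add_nonneg (hL0 a ha) (hM0 a ha)) (norm_nonneg _)
      have h := CfLip.norm_mk'_le (f := cfWFun A ω F) (C := (∑ a ∈ A, (L a + M a)) * ‖F‖)
        (M := (∑ a ∈ A, M a) * ‖F‖) hC (norm_cfWFun_sub_le A hA hM hL F) (norm_cfWFun_le A hM F)
      refine h.trans (le_of_eq ?_)
      rw [Finset.sum_mul, Finset.sum_mul, Finset.sum_mul, ← Finset.sum_add_distrib]
      exact Finset.sum_congr rfl fun a _ => by ring

/-- Pointwise formula for the weighted operator. [folklore] -/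
@[simp] theorem cfWOp_apply (ω : ℕ → ℝ → ℂ) (M L : ℕ → ℝ)
    (hM : ∀ a ∈ A, ∀ x ∈ Icc (0 : ℝ) 1, ‖ω a x‖ ≤ M a)
    (hL : ∀ a ∈ A, ∀ x ∈ Icc (0 : ℝ) 1, ∀ y ∈ Icc (0 : ℝ) 1, ‖ω a x - ω a y‖ ≤ L a * |x - y|)
    (hL0 : ∀ a ∈ A, 0 ≤ L a) (F : CfLip) (x : Icc (0 : ℝ) 1) :
    cfWOp A hA ω M L hM hL hL0 F x = ∑ a ∈ A, ω a x * F.extend (1 / (x + a)) := rfl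

/-- **Norm bound** `‖Σ_a ω_a ∘…‖ ≤ Σ_a (2 M_a + L_a)`. [folklore] -/
theorem norm_cfWOp_le (ω : ℕ → ℝ → ℂ) (M L : ℕ → ℝ)
    (hM : ∀ a ∈ A, ∀ x ∈ Icc (0 : ℝ) 1, ‖ω a x‖ ≤ M a)
    (hL : ∀ a ∈ A, ∀ x ∈ Icc (0 : ℝ) 1, ∀ y ∈ Icc (0 : ℝ) 1, ‖ω a x - ω a y‖ ≤ L a * |x - y|)
    (hL0 : ∀ a ∈ A, 0 ≤ L a) :
    ‖cfWOp A hA ω M L hM hL hL0‖ ≤ ∑ a ∈ A, (2 * M a + L a) := by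
  have hM0 : ∀ a ∈ A, 0 ≤ M a := fun a ha => (norm_nonneg _).trans (hM a ha _ ⟨le_rfl, zero_le_one⟩)
  exact LinearMap.mkContinuous_norm_le _
    (Finset.sum_nonneg fun a ha => by linarith [hM0 a ha, hL0 a ha]) _

/-- **Norm bound for an operator given pointwise by weights** (no need to construct it as a
`cfWOp`): if `T F x = Σ_a ω_a(x) F(1/(x+a))` on `[0,1]` then `‖T‖ ≤ Σ_a (2 M_a + L_a)`.
[folklore] -/
theorem opNorm_le_of_weights (T : CfLip →L[ℂ] CfLip) (ω : ℕ → ℝ → ℂ) (M L : ℕ → ℝ)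
    (hM : ∀ a ∈ A, ∀ x ∈ Icc (0 : ℝ) 1, ‖ω a x‖ ≤ M a)
    (hL : ∀ a ∈ A, ∀ x ∈ Icc (0 : ℝ) 1, ∀ y ∈ Icc (0 : ℝ) 1, ‖ω a x - ω a y‖ ≤ L a * |x - y|)
    (hL0 : ∀ a ∈ A, 0 ≤ L a)
    (hT : ∀ (F : CfLip) (x : Icc (0 : ℝ) 1), T F x = ∑ a ∈ A, ω a x * F.extend (1 / (x + a))) :
    ‖T‖ ≤ ∑ a ∈ A, (2 * M a + L a) := by
  have hM0 : ∀ a ∈ A, 0 ≤ M a := fun a ha => (norm_nonneg _).trans (hM a ha _ ⟨le_rfl, zero_le_one⟩)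
  refine ContinuousLinearMap.opNorm_le_bound _
    (Finset.sum_nonneg fun a ha => by linarith [hM0 a ha, hL0 a ha]) fun F => ?_
  have hsup : ∀ x, ‖T F x‖ ≤ (∑ a ∈ A, M a) * ‖F‖ := fun x => by
    rw [hT]; exact norm_cfWFun_le A hM F x
  have hlip : ∀ x y : Icc (0 : ℝ) 1, ‖T F x - T F y‖ ≤ (∑ a ∈ A, (L a + M a)) * ‖F‖ * |(x : ℝ) - y| :=
    fun x y => by rw [hT, hT]; exact norm_cfWFun_sub_le A hA hM hL F x y
  have hC : 0 ≤ (∑ a ∈ A, (L a + M a)) * ‖F‖ :=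
    mul_nonneg (Finset.sum_nonneg fun a ha => add_nonneg (hL0 a ha) (hM0 a ha)) (norm_nonneg _)
  calc ‖T F‖ ≤ (∑ a ∈ A, M a) * ‖F‖ + (∑ a ∈ A, (L a + M a)) * ‖F‖ := CfLip.norm_le_of_bounds hC hsup hlip
    _ = (∑ a ∈ A, (2 * M a + L a)) * ‖F‖ := by
        rw [Finset.sum_mul, Finset.sum_mul, Finset.sum_mul, ← Finset.sum_add_distrib]
        exact Finset.sum_congr rfl fun a _ => by ring

end Generic

/-! ### The derivative operator `L'_s` -/

/-- The derivative weights `-2 log(x+a) (x+a)^{-2s}`. [folklore] -/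
def cfWtD (s : ℂ) (a : ℕ) (x : ℝ) : ℂ := -(2 * (Real.log (x + a) : ℂ)) * cfWt s (cfGen a) x

/-- Sup bound for the derivative weights: `‖wt'_s‖ ≤ 2 log(a+1) Z_a(Re s)`. [folklore] -/
theorem norm_cfWtD_le {a : ℕ} (ha : 1 ≤ a) (s : ℂ) {x : ℝ} (hx : x ∈ Icc (0 : ℝ) 1) :
    ‖cfWtD s a x‖ ≤ 2 * Real.log ((a : ℝ) + 1) * cfZa a s.re := by
  obtain ⟨hl0, hl1⟩ := log_add_mem ha hx
  rw [cfWtD, norm_mul, norm_neg, norm_mul, Complex.norm_real, Real.norm_eq_abs, abs_of_nonneg hl0]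
  have h2 : ‖(2 : ℂ)‖ = 2 := by norm_num
  rw [h2]
  have hla : 0 ≤ Real.log ((a : ℝ) + 1) := hl0.trans hl1
  exact mul_le_mul (mul_le_mul_of_nonneg_left hl1 (by norm_num)) (norm_cfWt_cfGen_le ha s hx)
    (norm_nonneg _) (by positivity)

/-- Lipschitz bound for the derivative weights. [folklore] -/
theorem norm_cfWtD_sub_le {a : ℕ} (ha : 1 ≤ a) (s : ℂ) {x y : ℝ} (hx : x ∈ Icc (0 : ℝ) 1)
    (hy : y ∈ Icc (0 : ℝ) 1) :
    ‖cfWtD s a x - cfWtD s a y‖ ≤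
      (2 * cfZa a s.re + 2 * Real.log ((a : ℝ) + 1) * (cfZa a s.re * (2 * ‖s‖ * Real.exp (2 * ‖s‖)))) *
        |x - y| := by
  obtain ⟨hlx0, hlx1⟩ := log_add_mem ha hx
  obtain ⟨hly0, hly1⟩ := log_add_mem ha hy
  have e : cfWtD s a x - cfWtD s a y =
      -(2 * ((Real.log (x + a) : ℂ) - (Real.log (y + a) : ℂ))) * cfWt s (cfGen a) x +
        -(2 * (Real.log (y + a) : ℂ)) * (cfWt s (cfGen a) x - cfWt s (cfGen a) y) := by
    simp only [cfWtD]; ring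
  rw [e]
  have h2 : ‖(2 : ℂ)‖ = 2 := by norm_num
  have h1 : ‖-(2 * ((Real.log (x + a) : ℂ) - (Real.log (y + a) : ℂ))) * cfWt s (cfGen a) x‖ ≤
      2 * |x - y| * cfZa a s.re := by
    rw [norm_mul, norm_neg, norm_mul, h2, ← Complex.ofReal_sub, Complex.norm_real, Real.norm_eq_abs]
    exact mul_le_mul (mul_le_mul_of_nonneg_left (abs_log_add_sub_le ha hx hy) (by norm_num))
      (norm_cfWt_cfGen_le ha s hx) (norm_nonneg _) (by positivity)
  have h3 : ‖-(2 * (Real.log (y + a) : ℂ)) * (cfWt s (cfGen a) x - cfWt s (cfGen a) y)‖ ≤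
      2 * Real.log ((a : ℝ) + 1) * (cfZa a s.re * (2 * ‖s‖ * Real.exp (2 * ‖s‖)) * |x - y|) := by
    rw [norm_mul, norm_neg, norm_mul, h2, Complex.norm_real, Real.norm_eq_abs, abs_of_nonneg hly0]
    have hla : 0 ≤ Real.log ((a : ℝ) + 1) := hly0.trans hly1
    exact mul_le_mul (mul_le_mul_of_nonneg_left hly1 (by norm_num)) (norm_cfWt_cfGen_sub_le ha s hx hy)
      (norm_nonneg _) (by positivity)
  calc _ ≤ 2 * |x - y| * cfZa a s.re +
        2 * Real.log ((a : ℝ) + 1) * (cfZa a s.re * (2 * ‖s‖ * Real.exp (2 * ‖s‖)) * |x - y|) :=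
        (norm_add_le _ _).trans (add_le_add h1 h3)
    _ = _ := by ring

/-! ### The second-order Taylor estimate -/

/-- The Taylor remainder weights
`wt_{s+k} - wt_s - k wt'_s = wt_s (e^{-2k log(x+a)} - 1 + 2k log(x+a))`. [folklore] -/
theorem cfWt_taylor (s k : ℂ) (a : ℕ) (x : ℝ) :
    cfWt (s + k) (cfGen a) x - cfWt s (cfGen a) x - k * cfWtD s a x =
      cfWt s (cfGen a) x *
        (Complex.exp (-(2 * k * (Real.log (x + a) : ℂ))) - 1 - (-(2 * k * (Real.log (x + a) : ℂ)))) := by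
  have hsplit : cfWt (s + k) (cfGen a) x =
      cfWt s (cfGen a) x * Complex.exp (-(2 * k * (Real.log (x + a) : ℂ))) := by
    rw [cfWt_cfGen, cfWt_cfGen, ← Complex.exp_add]
    congr 1
    ring
  rw [hsplit, cfWtD]
  ring

/-- The difference of Taylor remainders `φ(z) = e^z - 1 - z`:
`φ(z₂ + w) - φ(z₂) = e^{z₂}(e^w - 1 - w) + (e^{z₂} - 1) w`. [folklore] -/
theorem cexp_taylor_sub (z₂ w : ℂ) :
    (Complex.exp (z₂ + w) - 1 - (z₂ + w)) - (Complex.exp z₂ - 1 - z₂) =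
      Complex.exp z₂ * (Complex.exp w - 1 - w) + (Complex.exp z₂ - 1) * w := by
  rw [Complex.exp_add]
  ring

/-- **Sup bound for the remainder weights:** for `‖k‖ (2 log(B+1) + 2) ≤ 1` (`a ≤ B`),
`‖wt_{s+k} - wt_s - k wt'_s‖ ≤ Z_a(Re s) · 4 log²(a+1) ‖k‖²`. [folklore] -/
theorem norm_cfWt_taylor_le {a B : ℕ} (ha : 1 ≤ a) (haB : a ≤ B) (s : ℂ) {k : ℂ}
    (hk : ‖k‖ * (2 * Real.log ((B : ℝ) + 1) + 2) ≤ 1) {x : ℝ} (hx : x ∈ Icc (0 : ℝ) 1) :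
    ‖cfWt (s + k) (cfGen a) x - cfWt s (cfGen a) x - k * cfWtD s a x‖ ≤
      cfZa a s.re * (4 * Real.log ((a : ℝ) + 1) ^ 2) * ‖k‖ ^ 2 := by
  obtain ⟨hl0, hl1⟩ := log_add_mem ha hx
  have hlB : Real.log ((a : ℝ) + 1) ≤ Real.log ((B : ℝ) + 1) :=
    Real.log_le_log (by positivity) (by exact_mod_cast Nat.succ_le_succ haB)
  have hlB0 : 0 ≤ Real.log ((B : ℝ) + 1) := Real.log_nonneg (by
    have : (0 : ℝ) ≤ B := Nat.cast_nonneg B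
    linarith)
  have hz : ‖(-(2 * k * (Real.log (x + a) : ℂ)))‖ = 2 * ‖k‖ * Real.log (x + a) := by
    rw [norm_neg, norm_mul, norm_mul, Complex.norm_real, Real.norm_eq_abs, abs_of_nonneg hl0]
    norm_num
  have hz1 : ‖(-(2 * k * (Real.log (x + a) : ℂ)))‖ ≤ 1 := by
    rw [hz]
    nlinarith [norm_nonneg k]
  rw [cfWt_taylor, norm_mul]
  have h1 := Complex.norm_exp_sub_one_sub_id_le hz1
  rw [hz] at h1
  have h2 : (2 * ‖k‖ * Real.log (x + a)) ^ 2 ≤ 4 * Real.log ((a : ℝ) + 1) ^ 2 * ‖k‖ ^ 2 := by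
    have h3 : 2 * ‖k‖ * Real.log (x + a) ≤ 2 * ‖k‖ * Real.log ((a : ℝ) + 1) :=
      mul_le_mul_of_nonneg_left hl1 (by positivity)
    calc (2 * ‖k‖ * Real.log (x + a)) ^ 2 ≤ (2 * ‖k‖ * Real.log ((a : ℝ) + 1)) ^ 2 :=
          pow_le_pow_left₀ (by positivity) h3 2
      _ = _ := by ring
  calc ‖cfWt s (cfGen a) x‖ * ‖Complex.exp (-(2 * k * (Real.log (x + a) : ℂ))) - 1 -
          -(2 * k * (Real.log (x + a) : ℂ))‖
      ≤ cfZa a s.re * (4 * Real.log ((a : ℝ) + 1) ^ 2 * ‖k‖ ^ 2) :=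
        mul_le_mul (norm_cfWt_cfGen_le ha s hx) (h1.trans h2) (norm_nonneg _) (cfZa_nonneg _ _)
    _ = _ := by ring

/-- **Lipschitz bound for the remainder weights:** for `‖k‖ (2 log(B+1) + 2) ≤ 1` (`a ≤ B`),
`‖r_k(x) - r_k(y)‖ ≤ Z_a(Re s) (8‖s‖e^{2‖s‖} log²(a+1) + 4e(1 + log(a+1))) ‖k‖² |x - y|`.
[folklore] -/
theorem norm_cfWt_taylor_sub_le {a B : ℕ} (ha : 1 ≤ a) (haB : a ≤ B) (s : ℂ) {k : ℂ}
    (hk : ‖k‖ * (2 * Real.log ((B : ℝ) + 1) + 2) ≤ 1) {x y : ℝ} (hx : x ∈ Icc (0 : ℝ) 1)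
    (hy : y ∈ Icc (0 : ℝ) 1) :
    ‖(cfWt (s + k) (cfGen a) x - cfWt s (cfGen a) x - k * cfWtD s a x) -
        (cfWt (s + k) (cfGen a) y - cfWt s (cfGen a) y - k * cfWtD s a y)‖ ≤
      cfZa a s.re * ((2 * ‖s‖ * Real.exp (2 * ‖s‖)) * (4 * Real.log ((a : ℝ) + 1) ^ 2) +
        4 * Real.exp 1 * (1 + Real.log ((a : ℝ) + 1))) * ‖k‖ ^ 2 * |x - y| := by
  obtain ⟨hlx0, hlx1⟩ := log_add_mem ha hx
  obtain ⟨hly0, hly1⟩ := log_add_mem ha hy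
  have hla : 0 ≤ Real.log ((a : ℝ) + 1) := hlx0.trans hlx1
  have hlB : Real.log ((a : ℝ) + 1) ≤ Real.log ((B : ℝ) + 1) :=
    Real.log_le_log (by positivity) (by exact_mod_cast Nat.succ_le_succ haB)
  have hlB0 : 0 ≤ Real.log ((B : ℝ) + 1) := Real.log_nonneg (by
    have : (0 : ℝ) ≤ B := Nat.cast_nonneg B
    linarith)
  have hk0 := norm_nonneg k
  have hk_half : 2 * ‖k‖ ≤ 1 := by nlinarith
  have hd1 : |x - y| ≤ 1 := by rw [abs_le]; constructor <;> linarith [hx.1, hx.2, hy.1, hy.2]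
  have hd0 : 0 ≤ |x - y| := abs_nonneg _
  -- the two exponents and their difference
  set z₁ : ℂ := -(2 * k * (Real.log (x + a) : ℂ)) with hz₁
  set z₂ : ℂ := -(2 * k * (Real.log (y + a) : ℂ)) with hz₂
  set w : ℂ := z₁ - z₂ with hw
  have hz₂n : ‖z₂‖ = 2 * ‖k‖ * Real.log (y + a) := by
    rw [hz₂, norm_neg, norm_mul, norm_mul, Complex.norm_real, Real.norm_eq_abs, abs_of_nonneg hly0]
    norm_num
  have hz₁n : ‖z₁‖ = 2 * ‖k‖ * Real.log (x + a) := by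
    rw [hz₁, norm_neg, norm_mul, norm_mul, Complex.norm_real, Real.norm_eq_abs, abs_of_nonneg hlx0]
    norm_num
  have hz₂1 : ‖z₂‖ ≤ 1 := by rw [hz₂n]; nlinarith
  have hz₁1 : ‖z₁‖ ≤ 1 := by rw [hz₁n]; nlinarith
  have hz₂l : ‖z₂‖ ≤ 2 * ‖k‖ * Real.log ((a : ℝ) + 1) := by
    rw [hz₂n]; exact mul_le_mul_of_nonneg_left hly1 (by positivity)
  have hwn : ‖w‖ ≤ 2 * ‖k‖ * |x - y| := by
    have e : w = -(2 * k) * ((Real.log (x + a) : ℂ) - (Real.log (y + a) : ℂ)) := by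
      rw [hw, hz₁, hz₂]; ring
    rw [e, norm_mul, norm_neg, norm_mul, ← Complex.ofReal_sub, Complex.norm_real, Real.norm_eq_abs]
    have h2 : ‖(2 : ℂ)‖ = 2 := by norm_num
    rw [h2]
    exact mul_le_mul_of_nonneg_left (abs_log_add_sub_le ha hx hy) (by positivity)
  have hw1 : ‖w‖ ≤ 1 := hwn.trans (by nlinarith)
  -- `φ(z₁) - φ(z₂)`
  have hφ : ‖(Complex.exp z₁ - 1 - z₁) - (Complex.exp z₂ - 1 - z₂)‖ ≤
      4 * Real.exp 1 * (1 + Real.log ((a : ℝ) + 1)) * ‖k‖ ^ 2 * |x - y| := by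
    have e : z₁ = z₂ + w := by rw [hw]; ring
    rw [e, cexp_taylor_sub]
    have h1 : ‖Complex.exp z₂ * (Complex.exp w - 1 - w)‖ ≤ Real.exp 1 * (4 * ‖k‖ ^ 2 * |x - y|) := by
      rw [norm_mul]
      refine mul_le_mul ((Complex.norm_exp_le_exp_norm z₂).trans (Real.exp_le_exp.2 hz₂1))
        ((Complex.norm_exp_sub_one_sub_id_le hw1).trans ?_) (norm_nonneg _) (by positivity)
      calc ‖w‖ ^ 2 ≤ (2 * ‖k‖ * |x - y|) ^ 2 := by gcongr
        _ = (4 * ‖k‖ ^ 2 * |x - y|) * |x - y| := by ring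
        _ ≤ (4 * ‖k‖ ^ 2 * |x - y|) * 1 := mul_le_mul_of_nonneg_left hd1 (by positivity)
        _ = _ := by ring
    have h2 : ‖(Complex.exp z₂ - 1) * w‖ ≤ (2 * ‖k‖ * Real.log ((a : ℝ) + 1) * Real.exp 1) * (2 * ‖k‖ * |x - y|) := by
      rw [norm_mul]
      refine mul_le_mul ?_ hwn (norm_nonneg _) (by positivity)
      have hbd : ‖Complex.exp z₂ - 1‖ ≤ ‖z₂‖ * Real.exp ‖z₂‖ := by
        have h := Complex.norm_exp_sub_sum_le_norm_mul_exp z₂ 1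
        simp only [Finset.range_one, Finset.sum_singleton, pow_zero, Nat.factorial_zero, Nat.cast_one,
          div_one, pow_one] at h
        exact h
      calc ‖Complex.exp z₂ - 1‖ ≤ ‖z₂‖ * Real.exp ‖z₂‖ := hbd
        _ ≤ (2 * ‖k‖ * Real.log ((a : ℝ) + 1)) * Real.exp 1 :=
            mul_le_mul hz₂l (Real.exp_le_exp.2 hz₂1) (Real.exp_pos _).le (by positivity)
    calc _ ≤ Real.exp 1 * (4 * ‖k‖ ^ 2 * |x - y|) +
          (2 * ‖k‖ * Real.log ((a : ℝ) + 1) * Real.exp 1) * (2 * ‖k‖ * |x - y|) :=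
          (norm_add_le _ _).trans (add_le_add h1 h2)
      _ = 4 * Real.exp 1 * (1 + Real.log ((a : ℝ) + 1)) * ‖k‖ ^ 2 * |x - y| := by ring
  -- `φ(z₁)` itself
  have hφ₁ : ‖Complex.exp z₁ - 1 - z₁‖ ≤ 4 * Real.log ((a : ℝ) + 1) ^ 2 * ‖k‖ ^ 2 := by
    refine (Complex.norm_exp_sub_one_sub_id_le hz₁1).trans ?_
    rw [hz₁n]
    have h3 : 2 * ‖k‖ * Real.log (x + a) ≤ 2 * ‖k‖ * Real.log ((a : ℝ) + 1) :=
      mul_le_mul_of_nonneg_left hlx1 (by positivity)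
    calc (2 * ‖k‖ * Real.log (x + a)) ^ 2 ≤ (2 * ‖k‖ * Real.log ((a : ℝ) + 1)) ^ 2 :=
          pow_le_pow_left₀ (by positivity) h3 2
      _ = _ := by ring
  -- assemble
  rw [cfWt_taylor, cfWt_taylor]
  have e : cfWt s (cfGen a) x * (Complex.exp z₁ - 1 - z₁) - cfWt s (cfGen a) y * (Complex.exp z₂ - 1 - z₂) =
      (cfWt s (cfGen a) x - cfWt s (cfGen a) y) * (Complex.exp z₁ - 1 - z₁) +
        cfWt s (cfGen a) y * ((Complex.exp z₁ - 1 - z₁) - (Complex.exp z₂ - 1 - z₂)) := by ring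
  rw [e]
  have hZ := cfZa_nonneg a s.re
  have t1 : ‖(cfWt s (cfGen a) x - cfWt s (cfGen a) y) * (Complex.exp z₁ - 1 - z₁)‖ ≤
      (cfZa a s.re * (2 * ‖s‖ * Real.exp (2 * ‖s‖)) * |x - y|) * (4 * Real.log ((a : ℝ) + 1) ^ 2 * ‖k‖ ^ 2) := by
    rw [norm_mul]
    exact mul_le_mul (norm_cfWt_cfGen_sub_le ha s hx hy) hφ₁ (norm_nonneg _) (by positivity)
  have t2 : ‖cfWt s (cfGen a) y * ((Complex.exp z₁ - 1 - z₁) - (Complex.exp z₂ - 1 - z₂))‖ ≤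
      cfZa a s.re * (4 * Real.exp 1 * (1 + Real.log ((a : ℝ) + 1)) * ‖k‖ ^ 2 * |x - y|) := by
    rw [norm_mul]
    exact mul_le_mul (norm_cfWt_cfGen_le ha s hy) hφ (norm_nonneg _) hZ
  calc _ ≤ (cfZa a s.re * (2 * ‖s‖ * Real.exp (2 * ‖s‖)) * |x - y|) * (4 * Real.log ((a : ℝ) + 1) ^ 2 * ‖k‖ ^ 2) +
        cfZa a s.re * (4 * Real.exp 1 * (1 + Real.log ((a : ℝ) + 1)) * ‖k‖ ^ 2 * |x - y|) :=
        (norm_add_le _ _).trans (add_le_add t1 t2)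
    _ = _ := by ring

variable (A) in
/-- The constant of the Taylor estimate:
`C(s) = Σ_a Z_a(Re s) (8 log²(a+1) + 8‖s‖e^{2‖s‖} log²(a+1) + 4e(1 + log(a+1)))`. [folklore] -/
def cfTaylorConst (s : ℂ) : ℝ :=
  ∑ a ∈ A, cfZa a s.re * (2 * (4 * Real.log ((a : ℝ) + 1) ^ 2) +
    ((2 * ‖s‖ * Real.exp (2 * ‖s‖)) * (4 * Real.log ((a : ℝ) + 1) ^ 2) +
      4 * Real.exp 1 * (1 + Real.log ((a : ℝ) + 1))))

section Deriv

variable (A) (hA : ∀ a ∈ A, 1 ≤ a)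
include hA

/-- **The derivative operator `L'_s`** on `CfLip`: weights `-2 log(x+a) (x+a)^{-2s}`.
[cite: MageeOhWinter2019, §3.4] -/
def cfLOpD (s : ℂ) : CfLip →L[ℂ] CfLip :=
  cfWOp A hA (cfWtD s) (fun a => 2 * Real.log ((a : ℝ) + 1) * cfZa a s.re)
    (fun a => 2 * cfZa a s.re + 2 * Real.log ((a : ℝ) + 1) * (cfZa a s.re * (2 * ‖s‖ * Real.exp (2 * ‖s‖))))
    (fun a ha x hx => norm_cfWtD_le (hA a ha) s hx)
    (fun a ha x hx y hy => norm_cfWtD_sub_le (hA a ha) s hx hy)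
    (fun a ha => by
      have := cfZa_nonneg a s.re
      have : 0 ≤ Real.log ((a : ℝ) + 1) := Real.log_nonneg (by
        have : (1 : ℝ) ≤ a := by exact_mod_cast hA a ha
        linarith)
      positivity)

/-- Pointwise formula for `L'_s`. [folklore] -/
@[simp] theorem cfLOpD_apply (s : ℂ) (F : CfLip) (x : Icc (0 : ℝ) 1) :
    cfLOpD A hA s F x = ∑ a ∈ A, cfWtD s a x * F.extend (1 / (x + a)) := rfl

/-- `C(s) ≥ 0`. [folklore] -/
theorem cfTaylorConst_nonneg (s : ℂ) : 0 ≤ cfTaylorConst A s := by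
  refine Finset.sum_nonneg fun a ha => mul_nonneg (cfZa_nonneg _ _) ?_
  have : 0 ≤ Real.log ((a : ℝ) + 1) := Real.log_nonneg (by
    have : (1 : ℝ) ≤ a := by exact_mod_cast hA a ha
    linarith)
  positivity

/-- The pointwise formula for the Taylor remainder operator. [folklore] -/
theorem cfLOp_taylor_apply (s k : ℂ) (F : CfLip) (x : Icc (0 : ℝ) 1) :
    (cfLOp A hA (s + k) - cfLOp A hA s - k • cfLOpD A hA s) F x =
      ∑ a ∈ A, (cfWt (s + k) (cfGen a) x - cfWt s (cfGen a) x - k * cfWtD s a x) *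
        F.extend (1 / (x + a)) := by
  simp only [FunLike.coe_sub, FunLike.coe_smul, Pi.sub_apply, Pi.smul_apply,
    CfLip.sub_apply, CfLip.smul_apply, cfLOp_apply, cfLOpD_apply, cfLC]
  rw [Finset.mul_sum, ← Finset.sum_sub_distrib, ← Finset.sum_sub_distrib]
  exact Finset.sum_congr rfl fun a _ => by ring

/-- **The second-order Taylor estimate in operator norm:** for `‖k‖ (2 log(B+1) + 2) ≤ 1` with
`B ≥ max A`, `‖L_{s+k} - L_s - k L'_s‖ ≤ C(s) ‖k‖²`. [cite: MageeOhWinter2019, §3.4] -/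
theorem norm_cfLOp_taylor_le {B : ℕ} (hB : ∀ a ∈ A, a ≤ B) (s : ℂ) {k : ℂ}
    (hk : ‖k‖ * (2 * Real.log ((B : ℝ) + 1) + 2) ≤ 1) :
    ‖cfLOp A hA (s + k) - cfLOp A hA s - k • cfLOpD A hA s‖ ≤ cfTaylorConst A s * ‖k‖ ^ 2 := by
  have h := opNorm_le_of_weights A hA (cfLOp A hA (s + k) - cfLOp A hA s - k • cfLOpD A hA s)
    (fun a x => cfWt (s + k) (cfGen a) x - cfWt s (cfGen a) x - k * cfWtD s a x)
    (fun a => cfZa a s.re * (4 * Real.log ((a : ℝ) + 1) ^ 2) * ‖k‖ ^ 2)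
    (fun a => cfZa a s.re * ((2 * ‖s‖ * Real.exp (2 * ‖s‖)) * (4 * Real.log ((a : ℝ) + 1) ^ 2) +
        4 * Real.exp 1 * (1 + Real.log ((a : ℝ) + 1))) * ‖k‖ ^ 2)
    (fun a ha x hx => norm_cfWt_taylor_le (hA a ha) (hB a ha) s hk hx)
    (fun a ha x hx y hy => norm_cfWt_taylor_sub_le (hA a ha) (hB a ha) s hk hx hy)
    (fun a ha => by
      have := cfZa_nonneg a s.re
      have : 0 ≤ Real.log ((a : ℝ) + 1) := Real.log_nonneg (by
        have : (1 : ℝ) ≤ a := by exact_mod_cast hA a ha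
        linarith)
      positivity)
    (cfLOp_taylor_apply A hA s k)
  refine h.trans (le_of_eq ?_)
  rw [cfTaylorConst, Finset.sum_mul]
  exact Finset.sum_congr rfl fun a _ => by ring

/-! ### Holomorphy -/

/-- **`s ↦ L_s` is differentiable in operator norm, with derivative `L'_s`.**
[cite: MageeOhWinter2019, §3.4] -/
theorem hasDerivAt_cfLOp (s : ℂ) : HasDerivAt (fun s => cfLOp A hA s) (cfLOpD A hA s) s := by
  rw [hasDerivAt_iff_isLittleO_nhds_zero]
  have hB : ∀ a ∈ A, a ≤ A.sup id := fun a ha => Finset.le_sup (f := id) ha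
  set C := cfTaylorConst A s with hCdef
  have hC : 0 ≤ C := cfTaylorConst_nonneg A hA s
  have hlog : 0 ≤ Real.log (((A.sup id : ℕ) : ℝ) + 1) := Real.log_nonneg (by
    have : (0 : ℝ) ≤ (A.sup id : ℕ) := Nat.cast_nonneg _
    linarith)
  set k₀ : ℝ := 1 / (2 * Real.log (((A.sup id : ℕ) : ℝ) + 1) + 2) with hk₀def
  have hk₀ : 0 < k₀ := by rw [hk₀def]; positivity
  refine isLittleO_iff.2 fun c hc => ?_
  have hr : 0 < min k₀ (c / (C + 1)) := lt_min hk₀ (by positivity)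
  filter_upwards [Metric.ball_mem_nhds (0 : ℂ) hr] with k hk
  rw [Metric.mem_ball, dist_zero_right] at hk
  have hk1 : ‖k‖ ≤ k₀ := (hk.trans_le (min_le_left _ _)).le
  have hk2 : ‖k‖ ≤ c / (C + 1) := (hk.trans_le (min_le_right _ _)).le
  have hk1' : ‖k‖ * (2 * Real.log (((A.sup id : ℕ) : ℝ) + 1) + 2) ≤ 1 := by
    rw [hk₀def, le_div_iff₀ (by positivity)] at hk1
    exact hk1
  have h := norm_cfLOp_taylor_le A hA hB s hk1'
  have hkn := norm_nonneg k
  calc ‖cfLOp A hA (s + k) - cfLOp A hA s - k • cfLOpD A hA s‖ ≤ C * ‖k‖ ^ 2 := h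
    _ = (C * ‖k‖) * ‖k‖ := by ring
    _ ≤ (C * (c / (C + 1))) * ‖k‖ := by gcongr
    _ ≤ c * ‖k‖ := by
        refine mul_le_mul_of_nonneg_right ?_ hkn
        rw [mul_div_assoc', div_le_iff₀ (by positivity)]
        nlinarith

/-- **`s ↦ L_s` is an entire operator-valued function.** [cite: MageeOhWinter2019, §3.4] -/
theorem differentiable_cfLOp : Differentiable ℂ fun s => cfLOp A hA s :=
  fun s => (hasDerivAt_cfLOp A hA s).differentiableAt

/-- The derivative of `s ↦ L_s` is `L'_s`. [folklore] -/
theorem deriv_cfLOp (s : ℂ) : deriv (fun s => cfLOp A hA s) s = cfLOpD A hA s :=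
  (hasDerivAt_cfLOp A hA s).deriv

/-- `s ↦ L_s` is continuous in operator norm. [folklore] -/
theorem continuous_cfLOp : Continuous fun s => cfLOp A hA s :=
  (differentiable_cfLOp A hA).continuous

/-- **`s ↦ L_s` is analytic** (holomorphic Banach-valued functions are analytic).
[cite: MageeOhWinter2019, §3.4] -/
theorem analyticAt_cfLOp (s : ℂ) : AnalyticAt ℂ (fun s => cfLOp A hA s) s :=
  (differentiable_cfLOp A hA).differentiableOn.analyticAt Filter.univ_mem

end Deriv

end Literature.NumberTheory.Sieve
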